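import Literature.Geometry.Riemannian.L2HarmonicOneFormsSobolev
import Mathlib.Geometry.Manifold.PartitionOfUnity
import Mathlib.Topology.Connected.LocallyConnected
import HarnessLib

/-!
# Ends of a manifold: components of the complement of a compact set and their cutoff functions
(Carron 2007, §2.1.1 and the construction of Lemma 2.1)

Second layer of the proof programme of `Carron1998_ends_le_rank_l2HarmonicOneForms`
(`L2HarmonicOneFormsSobolev.lean`). G. Carron, *L² harmonic forms on non-compact Riemannian
manifolds*, arXiv:0704.3194 (2007), proof of Lemma 2.1 (and of Prop. 2.5, Remark 2.6): "we can
find a compact set `K ⊂ M` such that `M ∖ K = U₋ ∪ U₊` where `U₋, U₊` are unbounded and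
`U₋ ∩ U₊ = ∅`. Let `u ∈ C^∞(M)` such that `u = ±1` on `U±`, then clearly `α = du` is a closed
`1`-form with compact support." Starting from the tree's `HasAtLeastEnds X k` (a compact `K` and
`k` points of `X ∖ K` with pairwise distinct, unbounded connected components in `X ∖ K`), this
file PROVES the topological bookkeeping and produces the cutoffs, for a Hausdorff, second
countable `C^∞` manifold over a finite-dimensional real model (any model with corners):

* `locallyConnectedSpace_of_modelWithCorners` — the model space `H` of a real model with corners
  is locally connected (it is homeomorphic to the convex set `range I`), whence so is every
  manifold modelled on it (Mathlib's `ChartedSpace.locallyConnectedSpace`);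
* `closure_connectedComponentIn_subset`, `disjoint_connectedComponentIn_of_ne` — components of
  an open set `F` in a locally connected space: `closure C ⊆ C ∪ Fᶜ`, distinct components are
  disjoint;
* `HasAtLeastEnds.exists_end_cutoffs` — **the configuration of Carron's Lemma 2.1 for `k`
  ends**: a compact `K`, an open relatively compact `V ⊇ K`, pairwise disjoint open components
  `C₁, …, C_k` of `X ∖ K` whose far parts `Cᵢ ∖ closure V` are still unbounded, and functions
  `χᵢ ∈ C^∞(X; [0, 1])` with `χᵢ = δᵢⱼ` on `Cⱼ ∖ closure V`, `χᵢ = 0` off `Cᵢ ∪ closure V`, and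
  `χᵢ` locally constant off the compact set `closure V` (so `dχᵢ` has compact support) — Mathlib's
  smooth Urysohn lemma `exists_contMDiffMap_zero_one_of_isClosed` applied to the disjoint closed
  sets `(Cᵢ ∪ V)ᶜ` and `Cᵢ ∖ V`.

Everything is proved; no definitions, no named facts (D-0026).

## References

* G. Carron, *L² harmonic forms on non-compact Riemannian manifolds*, arXiv:0704.3194 (2007),
  §2.1.1 (ends, bounded and unbounded sets), Lemma 2.1 and its proof. [`Carron2007`]
-/

noncomputable section

open Set Function Filter Topology
open scoped Manifold ContDiff

namespace Literature.Geometry.Riemannian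

/-! ### Local connectedness of real manifolds with corners -/

section LocallyConnected

variable {E : Type*} [NormedAddCommGroup E] [NormedSpace ℝ E] {H : Type*} [TopologicalSpace H]

/-- **The model space of a real model with corners is locally connected**: `I` is a closed
embedding of `H` onto the convex subset `range I` of the normed space `E`, and convex subsets of
normed spaces are locally path connected (Mathlib's `Convex.locallyPathConnectedSpace`).
[folklore] -/
theorem locallyConnectedSpace_of_modelWithCorners (I : ModelWithCorners ℝ E H) :
    LocallyConnectedSpace H := by
  haveI : LocallyPathConnectedSpace (range I) := I.convex_range.locallyPathConnectedSpace
  exact I.isClosedEmbedding.isEmbedding.toHomeomorph.locallyConnectedSpace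

/-- A manifold modelled on a real model with corners is locally connected (charts and
`locallyConnectedSpace_of_modelWithCorners`). [folklore] -/
theorem locallyConnectedSpace_of_chartedSpace (I : ModelWithCorners ℝ E H) (X : Type*)
    [TopologicalSpace X] [ChartedSpace H X] : LocallyConnectedSpace X := by
  haveI := locallyConnectedSpace_of_modelWithCorners I
  exact ChartedSpace.locallyConnectedSpace H X

end LocallyConnected

/-! ### Components of an open set in a locally connected space -/

section Components

variable {X : Type*} [TopologicalSpace X]

/-- Distinct connected components (in a set `F`) are disjoint. [folklore] -/
theorem disjoint_connectedComponentIn_of_ne {F : Set X} {x y : X}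
    (h : connectedComponentIn F x ≠ connectedComponentIn F y) :
    Disjoint (connectedComponentIn F x) (connectedComponentIn F y) := by
  rw [Set.disjoint_left]
  intro z hzx hzy
  exact h ((connectedComponentIn_eq hzx).trans (connectedComponentIn_eq hzy).symm)

/-- In a locally connected space, the closure of a connected component `C` of an open set `F`
stays inside `C ∪ Fᶜ` (components of open sets are open, and a component met by the closure of
another coincides with it). This is "`∂Uᵢ ⊆ K`" for the components `Uᵢ` of `M ∖ K`.
[folklore] -/
theorem closure_connectedComponentIn_subset [LocallyConnectedSpace X] {F : Set X}
    (hF : IsOpen F) (x : X) :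
    closure (connectedComponentIn F x) ⊆ connectedComponentIn F x ∪ Fᶜ := by
  intro y hy
  by_cases hyF : y ∈ F
  · left
    have hopen : IsOpen (connectedComponentIn F y) := hF.connectedComponentIn
    obtain ⟨z, hzy, hzx⟩ := mem_closure_iff.1 hy _ hopen (mem_connectedComponentIn hyF)
    rw [connectedComponentIn_eq hzx, ← connectedComponentIn_eq hzy]
    exact mem_connectedComponentIn hyF
  · right; exact hyF

/-- For a closed `K` in a locally connected space and a component `C` of `Kᶜ`, the set `C ∖ V` is
closed for every open `V ⊇ K` (`closure C ⊆ C ∪ K`). [folklore] -/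
theorem isClosed_connectedComponentIn_diff [LocallyConnectedSpace X] {K V : Set X}
    (hK : IsClosed K) (hV : IsOpen V) (hKV : K ⊆ V) (x : X) :
    IsClosed (connectedComponentIn Kᶜ x \ V) := by
  have heq : connectedComponentIn Kᶜ x \ V = closure (connectedComponentIn Kᶜ x) \ V := by
    refine Subset.antisymm (sdiff_subset_sdiff_left subset_closure) fun y hy ↦ ⟨?_, hy.2⟩
    rcases closure_connectedComponentIn_subset hK.isOpen_compl x hy.1 with h | h
    · exact h
    · exact absurd (hKV (not_notMem.1 h)) hy.2
  rw [heq]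
  exact isClosed_closure.sdiff hV

end Components

/-! ### The configuration of Carron's Lemma 2.1 -/

section Cutoffs

variable {E : Type*} [NormedAddCommGroup E] [NormedSpace ℝ E] [FiniteDimensional ℝ E]
  {H : Type*} [TopologicalSpace H] {I : ModelWithCorners ℝ E H}
  {X : Type*} [TopologicalSpace X] [ChartedSpace H X] [IsManifold I ∞ X]
  [T2Space X] [SecondCountableTopology X]

/-- **Cutoff functions adapted to `k` ends** (the construction in Carron's proof of Lemma 2.1,
"`M ∖ K = U₋ ∪ U₊` … let `u ∈ C^∞(M)` such that `u = ±1` on `U±`", for `k` ends). If the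
`C^∞` manifold `X` (Hausdorff, second countable, finite-dimensional real model with corners
`I`) has at least `k` ends, there are: a compact `K`; an open `V ⊇ K` with compact closure;
pairwise disjoint open sets `C₁, …, C_k ⊆ X ∖ K`, each the connected component in `X ∖ K` of
each of its points, whose far parts `Cᵢ ∖ closure V` have non-compact closure; and `C^∞`
functions `χ₁, …, χ_k : X → [0, 1]` with `χᵢ = δᵢⱼ` on `Cⱼ ∖ closure V`, `χᵢ = 0` off
`Cᵢ ∪ closure V`, and `χᵢ` locally constant at every point off `closure V`.
[cite: Carron2007, Lemma 2.1] -/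
theorem HasAtLeastEnds.exists_end_cutoffs {k : ℕ} (hk : HasAtLeastEnds X k) :
    ∃ (K V : Set X) (C : Fin k → Set X) (χ : Fin k → X → ℝ),
      IsCompact K ∧ IsOpen V ∧ K ⊆ V ∧ IsCompact (closure V) ∧
      (∀ i, IsOpen (C i)) ∧ (∀ i, C i ⊆ Kᶜ) ∧
      (∀ i, ∀ x ∈ C i, connectedComponentIn Kᶜ x = C i) ∧
      (Pairwise fun i j ↦ Disjoint (C i) (C j)) ∧
      (∀ i, ¬ IsCompact (closure (C i \ closure V))) ∧
      (∀ i, ContMDiff I 𝓘(ℝ, ℝ) ∞ (χ i)) ∧ (∀ i x, χ i x ∈ Icc (0 : ℝ) 1) ∧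
      (∀ i j, ∀ x ∈ C j \ closure V, χ i x = if i = j then 1 else 0) ∧
      (∀ i, ∀ x ∉ C i ∪ closure V, χ i x = 0) ∧
      (∀ i, ∀ x ∉ closure V, χ i =ᶠ[𝓝 x] fun _ ↦ χ i x) := by
  classical
  haveI : LocallyCompactSpace X := Manifold.locallyCompact_of_finiteDimensional I
  haveI : LocallyConnectedSpace X := locallyConnectedSpace_of_chartedSpace I X
  obtain ⟨K, hK, s, hcard, hsK, hunb, hpw⟩ := hk
  -- an open relatively compact neighbourhood `V` of `K`
  obtain ⟨V, hVo, hKV, hVc⟩ := exists_isOpen_superset_and_isCompact_closure hK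
  -- enumerate the `k` marked points and their components
  have hcard' : Fintype.card s = k := by rw [Fintype.card_coe, hcard]
  set e : s ≃ Fin k := Fintype.equivFinOfCardEq hcard' with he
  set pt : Fin k → X := fun i ↦ ((e.symm i : s) : X) with hpt
  have hpt_mem : ∀ i, pt i ∈ s := fun i ↦ (e.symm i).2
  have hpt_inj : Function.Injective pt := fun i j hij ↦
    e.symm.injective (Subtype.ext hij)
  set C : Fin k → Set X := fun i ↦ connectedComponentIn Kᶜ (pt i) with hC
  have hKc : IsClosed K := hK.isClosed
  have hCo : ∀ i, IsOpen (C i) := fun i ↦ hKc.isOpen_compl.connectedComponentIn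
  have hCK : ∀ i, C i ⊆ Kᶜ := fun i ↦ connectedComponentIn_subset _ _
  have hCeq : ∀ i, ∀ x ∈ C i, connectedComponentIn Kᶜ x = C i := fun i x hx ↦
    (connectedComponentIn_eq hx).symm
  have hCdisj : Pairwise fun i j ↦ Disjoint (C i) (C j) := by
    intro i j hij
    refine disjoint_connectedComponentIn_of_ne (hpw (hpt_mem i) (hpt_mem j) fun h ↦ hij ?_)
    exact hpt_inj h
  have hCcl : ∀ i, closure (C i) ⊆ C i ∪ K := fun i ↦ by
    simpa only [compl_compl] using closure_connectedComponentIn_subset hKc.isOpen_compl (pt i)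
  -- far parts are unbounded
  have hfar : ∀ i, ¬ IsCompact (closure (C i \ closure V)) := by
    intro i hc
    apply hunb (pt i) (hpt_mem i)
    have hsub : closure (C i) ⊆ closure (C i \ closure V) ∪ closure V := by
      have h1 : C i ⊆ (C i \ closure V) ∪ closure V := fun y hy ↦ by
        by_cases hyV : y ∈ closure V
        · exact Or.inr hyV
        · exact Or.inl ⟨hy, hyV⟩
      calc closure (C i) ⊆ closure ((C i \ closure V) ∪ closure V) := closure_mono h1
        _ = closure (C i \ closure V) ∪ closure V := by rw [closure_union, closure_closure]
    exact (hc.union hVc).of_isClosed_subset isClosed_closure hsub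
  -- the cutoffs
  have hχ : ∀ i, ∃ f : X → ℝ, ContMDiff I 𝓘(ℝ, ℝ) ∞ f ∧ (∀ x, f x ∈ Icc (0 : ℝ) 1) ∧
      EqOn f 0 (C i ∪ V)ᶜ ∧ EqOn f 1 (C i \ V) := by
    intro i
    have hA : IsClosed (C i \ V) := isClosed_connectedComponentIn_diff hKc hVo hKV (pt i)
    have hB : IsClosed (C i ∪ V)ᶜ := ((hCo i).union hVo).isClosed_compl
    have hd : Disjoint (C i ∪ V)ᶜ (C i \ V) := by
      rw [Set.disjoint_left]
      intro y hyB hyA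
      exact hyB (Or.inl hyA.1)
    obtain ⟨f, hf0, hf1, hf⟩ := exists_contMDiffMap_zero_one_of_isClosed I hB hA hd (n := ⊤)
    exact ⟨f, f.contMDiff, hf, hf0, hf1⟩
  choose χ hχs hχ01 hχ0 hχ1 using hχ
  refine ⟨K, V, C, χ, hK, hVo, hKV, hVc, hCo, hCK, hCeq, hCdisj, hfar, hχs, hχ01, ?_, ?_, ?_⟩
  · -- `χᵢ = δᵢⱼ` on `Cⱼ ∖ closure V`
    intro i j x hx
    by_cases hij : i = j
    · subst hij
      rw [if_pos rfl]
      exact hχ1 i ⟨hx.1, fun h ↦ hx.2 (subset_closure h)⟩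
    · rw [if_neg hij]
      refine hχ0 i fun h ↦ ?_
      rcases h with h | h
      · exact Set.disjoint_left.1 (hCdisj hij) h hx.1
      · exact hx.2 (subset_closure h)
  · -- `χᵢ = 0` off `Cᵢ ∪ closure V`
    intro i x hx
    refine hχ0 i fun h ↦ hx ?_
    rcases h with h | h
    · exact Or.inl h
    · exact Or.inr (subset_closure h)
  · -- locally constant off `closure V`
    intro i x hx
    by_cases hxC : x ∈ C i
    · have hnhds : C i ∩ (closure V)ᶜ ∈ 𝓝 x :=
        ((hCo i).inter isClosed_closure.isOpen_compl).mem_nhds ⟨hxC, hx⟩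
      have hx1 : χ i x = 1 := hχ1 i ⟨hxC, fun h ↦ hx (subset_closure h)⟩
      filter_upwards [hnhds] with y hy
      rw [hx1]
      exact hχ1 i ⟨hy.1, fun h ↦ hy.2 (subset_closure h)⟩
    · have hxcl : x ∉ closure (C i) := fun h ↦ by
        rcases hCcl i h with h' | h'
        · exact hxC h'
        · exact hx (subset_closure (hKV h'))
      have hnhds : (closure (C i))ᶜ ∩ (closure V)ᶜ ∈ 𝓝 x :=
        (isClosed_closure.isOpen_compl.inter isClosed_closure.isOpen_compl).mem_nhds ⟨hxcl, hx⟩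
      have hx0 : χ i x = 0 :=
        hχ0 i fun h ↦ h.elim (fun h ↦ hxC h) fun h ↦ hx (subset_closure h)
      filter_upwards [hnhds] with y hy
      rw [hx0]
      exact hχ0 i fun h ↦ h.elim (fun h ↦ hy.1 (subset_closure h)) fun h ↦ hy.2 (subset_closure h)

end Cutoffs

end Literature.Geometry.Riemannian

end
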